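import Summits.QuantumFields.YangMills.Theorems.ToronValleyVolumeLojasiewiczLocaliseRing
import HarnessLib

/-!
# Quadratic growth of the TWISTED periodic deficit, I: per-link consequences for every twist, the twist sign field on the comb, centre bookkeeping
# (helper file for the crux `TwistEaterVolume.QuadraticGrowth`, item stmt-QuantumFields-24320, LINE g15-A of ym-idea-4)

* §1 for EVERY twist `z`: each kinetic bond deficit, the twisted seam deficit `6L³ − timeCoupling(P_last, g·τ_z P₀)` and `½S(P₀)` are at most `F_z(P)` (✓`ringDeficit_eq_sums`);
  per link, consecutive slices are `2√F_z`-close, every slice is within `4L√F_z` of slice `0`, the twisted seam image of slice `0` is within `4L√F_z` of slice `0`,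
  and `√(2S(P₀)) ≤ 2√F_z` (`L ≥ 1`; the action is read off the FIRST bond, so no twist invariance of `S` is needed).
* §2 ★ `exists_twistSign` — for `L ≥ 2` and every `z` there is a CENTRAL sign field `λ : Site → SU(2)` with `λ 0 = 1`, `λ(x+e_k) = λ(x)·centreElem(z_k)` exactly when
  `x_k ∈ {0, −1}` and `λ(x+e_k) = λ(x)` otherwise (the product over the twisted directions of `−1` for `x_k ≠ 0`): it absorbs the composite twist `τ_z` on the
  comb tree and moves it to the wrap links.
* §3 centre helpers (`centreElem b` is an involution, central) and the quaternion form of an almost-twisted-commutation: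
  `‖q c q w − (±) q w q c‖ ≤ ‖c w c⁻¹ − centreElem(b)·w‖_F`.
HONEST FRAMING: bookkeeping; the crux is assembled in `…TwistEaterVolumeQuadraticGrowth`; ⟨24319⟩, the leaf `SharpTwistedLaplace` and Yang–Mills stay OPEN.  THEOREMS ONLY
(no definition, no `sorry`).
-/

set_option autoImplicit false

noncomputable section

open scoped Quaternion Matrix BigOperators
open Literature.MathematicalPhysics.QuantumFieldTheory hiding SU2
open Literature.MathematicalPhysics.QuantumLattice

namespace Summit.QuantumFields.YangMills.Theorems.TwistEaterVolume.Quadratic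

open Summit.QuantumFields.YangMills.Theorems.FemtoTransferGap
open Summit.QuantumFields.YangMills.Theorems.FemtoTransferGap.TT
open Summit.QuantumFields.YangMills.Theorems.FemtoTransferGap.TwoLattice
open Summit.QuantumFields.YangMills.Theorems.FemtoTransferGap.TwoLattice.Flat
open Summit.QuantumFields.YangMills.Theorems.FemtoTransferGap.TwoLattice.Cov
open Summit.QuantumFields.YangMills.Theorems.VirialFluxGap.RingDeficit
open Summit.QuantumFields.YangMills.Theorems.ToronValleyVolume.Lojasiewicz

variable {L : ℕ} [NeZero L]

/-! ## §1 Per-link consequences of a small TWISTED deficit -/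

/-- Each kinetic bond deficit is at most the total deficit, for every twist. [folklore] -/
theorem kinetic_le_ringDeficit_twist (z : Fin 3 → Bool) (P : (Fin (2 * L - 1 + 1) → GaugeConfig 3 L SU2) × (Site 3 L → SU2)) (i : Fin (2 * L - 1)) :
    6 * (L : ℝ) ^ 3 - timeCoupling su2Rep (P.1 i.castSucc) (P.1 i.succ) ≤ ringDeficit L z P := by
  rw [ringDeficit_eq_sums]
  have hA : 6 * (L : ℝ) ^ 3 - timeCoupling su2Rep (P.1 i.castSucc) (P.1 i.succ) ≤
      ∑ i : Fin (2 * L - 1), (6 * (L : ℝ) ^ 3 - timeCoupling su2Rep (P.1 i.castSucc) (P.1 i.succ)) :=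
    Finset.single_le_sum (f := fun i : Fin (2 * L - 1) => 6 * (L : ℝ) ^ 3 - timeCoupling su2Rep (P.1 i.castSucc) (P.1 i.succ))
      (fun j _ => by linarith [timeCoupling_su2Rep_le (P.1 j.castSucc) (P.1 j.succ)]) (Finset.mem_univ i)
  have hB : 0 ≤ 6 * (L : ℝ) ^ 3 - timeCoupling su2Rep (P.1 (Fin.last (2 * L - 1))) (gaugeTransform P.2 (twist3 z (P.1 0))) := by
    linarith [timeCoupling_su2Rep_le (P.1 (Fin.last (2 * L - 1))) (gaugeTransform P.2 (twist3 z (P.1 0)))]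
  have hC : 0 ≤ ∑ i : Fin (2 * L - 1), (1 / 2 : ℝ) * (wilsonAction su2Rep (P.1 i.castSucc) + wilsonAction su2Rep (P.1 i.succ)) :=
    Finset.sum_nonneg fun j _ => by linarith [wilsonAction_su2_nonneg_lat (P.1 j.castSucc), wilsonAction_su2_nonneg_lat (P.1 j.succ)]
  have hD : 0 ≤ (1 / 2 : ℝ) * (wilsonAction su2Rep (P.1 (Fin.last (2 * L - 1))) + wilsonAction su2Rep (gaugeTransform P.2 (twist3 z (P.1 0)))) := by
    linarith [wilsonAction_su2_nonneg_lat (P.1 (Fin.last (2 * L - 1))), wilsonAction_su2_nonneg_lat (gaugeTransform P.2 (twist3 z (P.1 0)))]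
  linarith

/-- The twisted seam bond deficit is at most the total deficit. [folklore] -/
theorem seam_le_ringDeficit_twist (z : Fin 3 → Bool) (P : (Fin (2 * L - 1 + 1) → GaugeConfig 3 L SU2) × (Site 3 L → SU2)) :
    6 * (L : ℝ) ^ 3 - timeCoupling su2Rep (P.1 (Fin.last (2 * L - 1))) (gaugeTransform P.2 (twist3 z (P.1 0))) ≤ ringDeficit L z P := by
  rw [ringDeficit_eq_sums]
  have hA : 0 ≤ ∑ i : Fin (2 * L - 1), (6 * (L : ℝ) ^ 3 - timeCoupling su2Rep (P.1 i.castSucc) (P.1 i.succ)) :=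
    Finset.sum_nonneg fun j _ => by linarith [timeCoupling_su2Rep_le (P.1 j.castSucc) (P.1 j.succ)]
  have hC : 0 ≤ ∑ i : Fin (2 * L - 1), (1 / 2 : ℝ) * (wilsonAction su2Rep (P.1 i.castSucc) + wilsonAction su2Rep (P.1 i.succ)) :=
    Finset.sum_nonneg fun j _ => by linarith [wilsonAction_su2_nonneg_lat (P.1 j.castSucc), wilsonAction_su2_nonneg_lat (P.1 j.succ)]
  have hD : 0 ≤ (1 / 2 : ℝ) * (wilsonAction su2Rep (P.1 (Fin.last (2 * L - 1))) + wilsonAction su2Rep (gaugeTransform P.2 (twist3 z (P.1 0)))) := by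
    linarith [wilsonAction_su2_nonneg_lat (P.1 (Fin.last (2 * L - 1))), wilsonAction_su2_nonneg_lat (gaugeTransform P.2 (twist3 z (P.1 0)))]
  linarith

/-- The spatial action of the first slice is at most twice the total deficit, for every twist (read off the first kinetic bond's action term). [folklore] -/
theorem wilsonAction_first_le_ringDeficit_twist (z : Fin 3 → Bool) (P : (Fin (2 * L - 1 + 1) → GaugeConfig 3 L SU2) × (Site 3 L → SU2)) :
    wilsonAction su2Rep (P.1 0) ≤ 2 * ringDeficit L z P := by
  rw [ringDeficit_eq_sums]
  have hL1 : 1 ≤ L := NeZero.one_le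
  have hN : 0 < 2 * L - 1 := by omega
  set i₀ : Fin (2 * L - 1) := ⟨0, hN⟩ with hi₀
  have hcs : P.1 i₀.castSucc = P.1 0 := by rw [hi₀]; rfl
  have hA : 0 ≤ ∑ i : Fin (2 * L - 1), (6 * (L : ℝ) ^ 3 - timeCoupling su2Rep (P.1 i.castSucc) (P.1 i.succ)) :=
    Finset.sum_nonneg fun j _ => by linarith [timeCoupling_su2Rep_le (P.1 j.castSucc) (P.1 j.succ)]
  have hB : 0 ≤ 6 * (L : ℝ) ^ 3 - timeCoupling su2Rep (P.1 (Fin.last (2 * L - 1))) (gaugeTransform P.2 (twist3 z (P.1 0))) := by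
    linarith [timeCoupling_su2Rep_le (P.1 (Fin.last (2 * L - 1))) (gaugeTransform P.2 (twist3 z (P.1 0)))]
  have hC : (1 / 2 : ℝ) * (wilsonAction su2Rep (P.1 i₀.castSucc) + wilsonAction su2Rep (P.1 i₀.succ)) ≤
      ∑ i : Fin (2 * L - 1), (1 / 2 : ℝ) * (wilsonAction su2Rep (P.1 i.castSucc) + wilsonAction su2Rep (P.1 i.succ)) :=
    Finset.single_le_sum (f := fun i : Fin (2 * L - 1) => (1 / 2 : ℝ) * (wilsonAction su2Rep (P.1 i.castSucc) + wilsonAction su2Rep (P.1 i.succ)))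
      (fun j _ => by linarith [wilsonAction_su2_nonneg_lat (P.1 j.castSucc), wilsonAction_su2_nonneg_lat (P.1 j.succ)]) (Finset.mem_univ i₀)
  have hD : 0 ≤ (1 / 2 : ℝ) * (wilsonAction su2Rep (P.1 (Fin.last (2 * L - 1))) + wilsonAction su2Rep (gaugeTransform P.2 (twist3 z (P.1 0)))) := by
    linarith [wilsonAction_su2_nonneg_lat (P.1 (Fin.last (2 * L - 1))), wilsonAction_su2_nonneg_lat (gaugeTransform P.2 (twist3 z (P.1 0)))]
  rw [hcs] at hC
  have hs : 0 ≤ wilsonAction su2Rep (P.1 i₀.succ) := wilsonAction_su2_nonneg_lat _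
  linarith

/-- Consecutive slices are `2√F_z`-close on every link. [folklore] -/
theorem fd_step_le_twist (z : Fin 3 → Bool) (P : (Fin (2 * L - 1 + 1) → GaugeConfig 3 L SU2) × (Site 3 L → SU2)) (i : Fin (2 * L - 1)) (e : Edge 3 L) :
    fd (P.1 i.castSucc e) (P.1 i.succ e) ≤ 2 * Real.sqrt (ringDeficit L z P) := by
  have h1 := norm_sq_le_timeCoupling_deficit (P.1 i.castSucc) (P.1 i.succ) e
  have h2 := kinetic_le_ringDeficit_twist z P i
  have h3 : ‖su2Quat (P.1 i.castSucc e) - su2Quat (P.1 i.succ e)‖ ≤ Real.sqrt (ringDeficit L z P) := Real.le_sqrt_of_sq_le (by linarith)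
  linarith [fd_le_two_mul_norm_su2Quat_sub (P.1 i.castSucc e) (P.1 i.succ e)]

/-- Every slice is within `k·2√F_z` of slice `0` on every link (`k` = its index). [folklore] -/
theorem fd_slice_zero_le_twist (z : Fin 3 → Bool) (P : (Fin (2 * L - 1 + 1) → GaugeConfig 3 L SU2) × (Site 3 L → SU2)) (e : Edge 3 L) :
    ∀ (k : ℕ) (hk : k < 2 * L - 1 + 1), fd (P.1 ⟨k, hk⟩ e) (P.1 0 e) ≤ k * (2 * Real.sqrt (ringDeficit L z P)) := by
  intro k
  induction k with
  | zero => intro hk; simp [show (⟨0, hk⟩ : Fin (2 * L - 1 + 1)) = 0 from rfl, fd_self]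
  | succ k ih =>
    intro hk
    have hk' : k < 2 * L - 1 := by omega
    have hs := fd_step_le_twist z P ⟨k, hk'⟩ e
    have e1 : (⟨k, hk'⟩ : Fin (2 * L - 1)).castSucc = ⟨k, by omega⟩ := rfl
    have e2 : (⟨k, hk'⟩ : Fin (2 * L - 1)).succ = ⟨k + 1, hk⟩ := rfl
    rw [e1, e2] at hs
    have := ih (by omega)
    rw [fd_comm] at hs
    push_cast
    linarith [fd_triangle (P.1 ⟨k + 1, hk⟩ e) (P.1 ⟨k, by omega⟩ e) (P.1 0 e)]

/-- Every slice is within `4L√F_z` of slice `0` on every link. [folklore] -/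
theorem fd_slice_zero_le_twist' (z : Fin 3 → Bool) (P : (Fin (2 * L - 1 + 1) → GaugeConfig 3 L SU2) × (Site 3 L → SU2)) (i : Fin (2 * L - 1 + 1)) (e : Edge 3 L) :
    fd (P.1 i e) (P.1 0 e) ≤ 4 * (L : ℝ) * Real.sqrt (ringDeficit L z P) := by
  have h := fd_slice_zero_le_twist z P e i.val i.isLt
  have hi : (i.val : ℝ) ≤ 2 * (L : ℝ) := by
    have : i.val ≤ 2 * L := by omega
    exact_mod_cast this
  have hs := Real.sqrt_nonneg (ringDeficit L z P)
  calc fd (P.1 i e) (P.1 0 e) = fd (P.1 ⟨i.val, i.isLt⟩ e) (P.1 0 e) := rfl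
    _ ≤ i.val * (2 * Real.sqrt (ringDeficit L z P)) := h
    _ ≤ 2 * (L : ℝ) * (2 * Real.sqrt (ringDeficit L z P)) := mul_le_mul_of_nonneg_right hi (by positivity)
    _ = 4 * (L : ℝ) * Real.sqrt (ringDeficit L z P) := by ring

/-- The seam gauge field moves the TWISTED slice `0` to within `4L√F_z` of slice `0` on every link. [folklore] -/
theorem fd_seam_twist_le (z : Fin 3 → Bool) (P : (Fin (2 * L - 1 + 1) → GaugeConfig 3 L SU2) × (Site 3 L → SU2)) (e : Edge 3 L) :
    fd (P.1 0 e) (gaugeTransform P.2 (twist3 z (P.1 0)) e) ≤ 4 * (L : ℝ) * Real.sqrt (ringDeficit L z P) := by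
  set r := Real.sqrt (ringDeficit L z P) with hr
  have hs : 0 ≤ r := Real.sqrt_nonneg _
  have h1 := norm_sq_le_timeCoupling_deficit (P.1 (Fin.last (2 * L - 1))) (gaugeTransform P.2 (twist3 z (P.1 0))) e
  have h2 := seam_le_ringDeficit_twist z P
  have h3 : ‖su2Quat (P.1 (Fin.last (2 * L - 1)) e) - su2Quat (gaugeTransform P.2 (twist3 z (P.1 0)) e)‖ ≤ r := Real.le_sqrt_of_sq_le (by linarith)
  have h4 : fd (P.1 (Fin.last (2 * L - 1)) e) (gaugeTransform P.2 (twist3 z (P.1 0)) e) ≤ 2 * r := by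
    linarith [fd_le_two_mul_norm_su2Quat_sub (P.1 (Fin.last (2 * L - 1)) e) (gaugeTransform P.2 (twist3 z (P.1 0)) e)]
  have h5 := fd_slice_zero_le_twist z P e (2 * L - 1) (by omega)
  have e5 : (⟨2 * L - 1, by omega⟩ : Fin (2 * L - 1 + 1)) = Fin.last (2 * L - 1) := rfl
  rw [e5] at h5
  have hL1 : 1 ≤ L := NeZero.one_le
  have hN : (((2 * L - 1 : ℕ) : ℝ)) = 2 * (L : ℝ) - 1 := by rw [Nat.cast_sub (by omega), Nat.cast_mul]; push_cast; ring
  rw [hN, fd_comm] at h5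
  calc fd (P.1 0 e) (gaugeTransform P.2 (twist3 z (P.1 0)) e)
      ≤ fd (P.1 0 e) (P.1 (Fin.last (2 * L - 1)) e) + fd (P.1 (Fin.last (2 * L - 1)) e) (gaugeTransform P.2 (twist3 z (P.1 0)) e) := fd_triangle _ _ _
    _ ≤ (2 * (L : ℝ) - 1) * (2 * r) + 2 * r := add_le_add h5 h4
    _ = 4 * (L : ℝ) * r := by ring

/-- `√(2S(P₀)) ≤ 2√F_z`. [folklore] -/
theorem sqrt_two_action_le_twist (z : Fin 3 → Bool) (P : (Fin (2 * L - 1 + 1) → GaugeConfig 3 L SU2) × (Site 3 L → SU2)) :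
    Real.sqrt (2 * wilsonAction su2Rep (P.1 0)) ≤ 2 * Real.sqrt (ringDeficit L z P) := by
  have h := wilsonAction_first_le_ringDeficit_twist z P
  have h4 : 2 * wilsonAction su2Rep (P.1 0) ≤ 2 ^ 2 * ringDeficit L z P := by linarith
  calc Real.sqrt (2 * wilsonAction su2Rep (P.1 0)) ≤ Real.sqrt (2 ^ 2 * ringDeficit L z P) := Real.sqrt_le_sqrt h4
    _ = 2 * Real.sqrt (ringDeficit L z P) := by
        rw [Real.sqrt_mul (by norm_num), Real.sqrt_sq (by norm_num)]

/-! ## §2 The twist sign field on the comb -/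

/-- `centreElem b` is an involution. [folklore] -/
theorem centreElem_mul_self (b : Bool) : centreElem b * centreElem b = 1 := by
  rw [centreElem_mul, Bool.xor_self]; rfl

/-- `centreElem b` is its own inverse. [folklore] -/
theorem centreElem_inv (b : Bool) : (centreElem b)⁻¹ = centreElem b :=
  inv_eq_of_mul_eq_one_right (centreElem_mul_self b)

/-- Central elements commute with everything. [folklore] -/
theorem centre_comm {c : SU2} (hc : c ∈ Subgroup.center SU2) (g : SU2) : c * g = g * c :=
  (Subgroup.mem_center_iff.mp hc g).symm

omit [NeZero L] in
/-- ★ **The twist sign field.**  For `L ≥ 2` and every `z` there is a central `λ : Site → SU(2)` with `λ 0 = 1` and, across the edge `(x, k)`: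
`λ(x + e_k) = λ(x) · centreElem(z_k)` if `x_k = 0` or `x_k = −1`, and `λ(x + e_k) = λ(x)` otherwise (the field `Π_{k : z_k, x_k ≠ 0} (−1)`).
[folklore] -/
theorem exists_twistSign (hL : 2 ≤ L) (z : Fin 3 → Bool) :
    ∃ lam : Site 3 L → SU2, (∀ x, lam x ∈ Subgroup.center SU2) ∧ lam 0 = 1 ∧
      (∀ (x : Site 3 L) (k : Fin 3), (x k = 0 ∨ x k = -1) → lam (x.shift k) = lam x * centreElem (z k)) ∧
      (∀ (x : Site 3 L) (k : Fin 3), x k ≠ 0 → x k ≠ -1 → lam (x.shift k) = lam x) := by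
  haveI : Fact (1 < L) := ⟨hL⟩
  -- one factor per direction
  let f : Fin 3 → Site 3 L → SU2 := fun k x => if x k = 0 then 1 else centreElem (z k)
  have hf_center : ∀ k x, f k x ∈ Subgroup.center SU2 := fun k x => by
    simp only [f]; split_ifs
    · exact Subgroup.one_mem _
    · exact centreElem_mem_center _
  let lam : Site 3 L → SU2 := fun x => f 0 x * f 1 x * f 2 x
  have hone : (1 : ZMod L) ≠ 0 := by
    intro h
    have := ZMod.val_one L
    rw [h, ZMod.val_zero] at this
    exact zero_ne_one this
  -- behaviour of one factor under the shift in its own direction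
  have hself : ∀ (x : Site 3 L) (k : Fin 3), f k (x.shift k) = f k x * (if x k = 0 ∨ x k = -1 then centreElem (z k) else 1) := by
    intro x k
    have hsk : (x.shift k) k = x k + 1 := by simp [Site.shift]
    simp only [f]
    rw [hsk]
    by_cases h0 : x k = 0
    · rw [h0, zero_add, if_neg hone, if_pos rfl, if_pos (Or.inl rfl), one_mul]
    · by_cases h1 : x k = -1
      · rw [h1, neg_add_cancel, if_pos rfl, if_neg (by rw [← h1]; exact h0), if_pos (Or.inr rfl), centreElem_mul_self]
      · have h2 : x k + 1 ≠ 0 := fun h => h1 (eq_neg_of_add_eq_zero_left h)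
        rw [if_neg h2, if_neg h0, if_neg (by push Not; exact ⟨h0, h1⟩), mul_one]
  -- the other factors do not change
  have hother : ∀ (x : Site 3 L) (k j : Fin 3), j ≠ k → f j (x.shift k) = f j x := by
    intro x k j hjk
    simp only [f, shift_apply_ne x hjk]
  -- the product changes by the factor of direction `k` (everything is central)
  have hprod : ∀ (x : Site 3 L) (k : Fin 3), lam (x.shift k) = lam x * (if x k = 0 ∨ x k = -1 then centreElem (z k) else 1) := by
    intro x k
    have hk3 : k = 0 ∨ k = 1 ∨ k = 2 := by fin_cases k <;> simp
    have hdc : ∀ g : SU2, (if x k = 0 ∨ x k = -1 then centreElem (z k) else 1) * g = g * (if x k = 0 ∨ x k = -1 then centreElem (z k) else 1) := by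
      intro g; split_ifs
      · exact centre_comm (centreElem_mem_center (z k)) g
      · rw [one_mul, mul_one]
    have hs := hself x k
    show f 0 (x.shift k) * f 1 (x.shift k) * f 2 (x.shift k) = f 0 x * f 1 x * f 2 x * (if x k = 0 ∨ x k = -1 then centreElem (z k) else 1)
    rcases hk3 with rfl | rfl | rfl
    · rw [hs, hother x 0 1 (by decide), hother x 0 2 (by decide), mul_assoc (f 0 x) _ (f 1 x), hdc, mul_assoc (f 0 x), mul_assoc (f 1 x), hdc]
      simp only [mul_assoc]
    · rw [hs, hother x 1 0 (by decide), hother x 1 2 (by decide)]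
      simp only [mul_assoc]
      rw [hdc]
    · rw [hs, hother x 2 0 (by decide), hother x 2 1 (by decide)]
      simp only [mul_assoc]
  refine ⟨lam, fun x => ?_, ?_, fun x k hk => ?_, fun x k h0 h1 => ?_⟩
  · exact Subgroup.mul_mem _ (Subgroup.mul_mem _ (hf_center 0 x) (hf_center 1 x)) (hf_center 2 x)
  · simp [lam, f]
  · rw [hprod, if_pos hk]
  · rw [hprod, if_neg (by push Not; exact ⟨h0, h1⟩), mul_one]

/-! ## §3 The quaternion form of an almost-twisted-commutation -/

/-- `‖q c · q w − (±) q w · q c‖ ≤ ‖c w c⁻¹ − centreElem(b)·w‖_F` (`−` for `b = false`, `+` for `b = true`). [folklore] -/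
theorem norm_quat_twist_le_fd (c w : SU2) (b : Bool) :
    ‖su2Quat c * su2Quat w - (if b then -(su2Quat w * su2Quat c) else su2Quat w * su2Quat c)‖ ≤ fd (c * w * c⁻¹) (centreElem b * w) := by
  have h1 : su2Quat c * su2Quat w - (if b then -(su2Quat w * su2Quat c) else su2Quat w * su2Quat c) =
      (su2Quat (c * w * c⁻¹) - su2Quat (centreElem b * w)) * su2Quat c := by
    rw [sub_mul, su2Quat_mul, su2Quat_mul, su2Quat_mul, mul_assoc (su2Quat c * su2Quat w), ← su2Quat_mul c⁻¹ c, inv_mul_cancel, su2Quat_one,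
      mul_one]
    cases b
    · simp [centreElem, su2Quat_one]
    · simp [centreElem, su2Quat_negOne]
  rw [h1, norm_mul, norm_su2Quat, mul_one]
  exact norm_su2Quat_sub_le_fd _ _

end Summit.QuantumFields.YangMills.Theorems.TwistEaterVolume.Quadratic

end
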